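import Summits.MatrixMultiplication.OmegaCensus.ThreeSetZ5Z5CoverKitE3Split
import Summits.MatrixMultiplication.OmegaCensus.DominoZ5Z5Data19S0
import HarnessLib

/-!
# Three-margin cover computations for `(1,9,12)@325`, hole class `σ = 0`, flagged row `23`, piece `P1` (235749 nodes)

ω-census `pub-omega`, family (b3), seat pub-omega-group gen 38.  Framing: lottery ticket; floor = certified bounds/negative ranges.
VALUE: kernel computations of the `ℤ₅²` stage of the census cell `(1,9,12)@325` of `ℤ₅ × ℤ₆₅` (design `HOME/pub-omega-group-g37/DESIGN-1-9-12.md`);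
NOT progress on ω.  Sizing (re-planned after '(kernel) excessive memory consumption' bounces of single 8-column groups of 184k–235k
enumeration nodes on loaded farm nodes): every `decide + kernel` here has ≤ 150k `rowsEnumE3` nodes (a whole group of 8 flagged columns, or a
half of 4 via `List.take 4` / `List.drop 4`), every file ≤ 280k; halves and groups are recombined in `DominoZ5Z5Join19Sσ`
(`coverGenE3_of_halves`, `coverGenE3_of_chunks`).  Model: `HOME/pub-omega-group-g38/code/colcost.py`.
-/

namespace Summit.MatrixMultiplication.OmegaCensus

namespace Z5Z5ThreeSet

open ZpZpDomino

set_option maxRecDepth 100000 in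
set_option maxHeartbeats 4000000 in
/-- Cover computation: flagged row `23`, column group `2` (132124 enumeration nodes). [folklore] -/
theorem cov19s0_r23_c2 : coverGenE3 tree19s0 exc19s0 10 (rowWs 5 10) (diagIdx 5) [flR19s0.getD 23 []] (flCg19s0.getD 2 [])
    flD19s0 (offs 5 10) (off 5 10 1) (off 5 10 2) = true := by decide +kernel

set_option maxRecDepth 100000 in
set_option maxHeartbeats 4000000 in
/-- Cover computation: flagged row `23`, column group `1` (103625 enumeration nodes). [folklore] -/
theorem cov19s0_r23_c1 : coverGenE3 tree19s0 exc19s0 10 (rowWs 5 10) (diagIdx 5) [flR19s0.getD 23 []] (flCg19s0.getD 1 [])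
    flD19s0 (offs 5 10) (off 5 10 1) (off 5 10 2) = true := by decide +kernel

end Z5Z5ThreeSet

end Summit.MatrixMultiplication.OmegaCensus
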